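import Mathlib.Tactic.NormNum.Prime
import Summits.MatrixMultiplication.OmegaCensus.PowBox

/-!
# ω-census, family (b3): conjecture C9 (b) — the rank-two atom `𝔽₁₆₉ ⋊ C₇` (`p = 13`, `k = ord₇ 13 = 2`) by prescribed-power certificates

HONEST FRAMING (pub-omega census; verbatim): lottery ticket; floor = certified bounds/negative ranges.
Census BOOKKEEPING (conjecture C9 of the cell, STRUCTURE.md §2, `BoxRatioSectionLaw`; pub-omega stpp-1 gen 23, the atom lane).
Nothing here is progress on `ω`.

After `TwoGenBoxMain` (every prime `p ≥ 5` except `7, 13, 19`, two independent powers `x, u x`) and `PowBoxSmall`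
(`p = 3, 7, 13, 19` with three independent powers, `p = 2` with four), the only Schmidt atom `𝔽_{p^k} ⋊ μ_q` (`q ≥ 5`) with
`k ≥ 2` not reached at the model level is `(p, q) = (13, 7)`: here `k = 2`, so `u² x = τ·u x − x` with
`τ = ζ + ζ⁻¹ ∈ {7, 8, 10} ⊂ 𝔽₁₃` (the roots of `t³ + t² − 2t − 1`, one for each conjugate pair of primitive `7`-th roots of
unity in `𝔽₁₆₉`), and only TWO powers are independent while `p = 13` is out of reach of the two-generator intervals.  The cure:
three-power shapes (`PowBox.Shape`, exponent sums `≤ 2`) whose third prescribed value is FORCED, `s₂ = τ s₁ − s₀`; for each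
`τ ∈ {7, 8, 10}` a one-dimensional certificate (`26/117`, `26/117`, `24/117 ≥ (9/5)·13 = 23.4`) was found by search and
re-verified in the honest ring `𝔽₁₃[X]/(X² − τX + 1)` (seat code `code/search_13_7.py`, `code/verify_quad.py`).
**`not_boxUseful_13_k2`**: for every finite commutative ring `R`, `u ∈ R` with `u ^ q = 1`, `x ∈ R` with
`u (u x) = τ (u x) − x` for some `τ ∈ {7, 8, 10}` and such that every pair of values on `x, u x` is realised by an additive
`λ : R → 𝔽₁₃`: `¬ BoxUseful (R ⋊_u ℤ/q)`.  With the earlier files: EVERY `(R ⋊_u ℤ/q, x)` over EVERY prime `p` with `x, u x`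
independent is box-useless, except that `p ∈ {2, 3, 7, 19}` ask for three (for `p = 2` four) independent powers and `p = 13`
asks for three independent powers or the rank-two relation above.
-/

namespace Summit.MatrixMultiplication.OmegaCensus

open Finset ProductBoxBound

namespace PowBox

variable {R : Type*} [CommRing R] [Fintype R] [DecidableEq R] {q : ℕ} [NeZero q] {u : R} [Fact (u ^ q = 1)]

omit [Fintype R] [DecidableEq R] in
/-- In rank two (`u (u x) = τ (u x) − x`, `x, u x` separated by functionals into `𝔽_p`, `p ≠ 2`): `2 < q`. [folklore] -/
theorem two_lt_q_of_rank_two {p : ℕ} [Fact p.Prime] (hp2 : p ≠ 2) {x : R} (τ : ℕ) (hrel : u * (u * x) = (τ : R) * (u * x) - x)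
    (hfun : ∀ t0 t1 : ZMod p, ∃ lam : R →+ ZMod p, lam x = t0 ∧ lam (u * x) = t1) : 2 < q := by
  by_contra hq
  push Not at hq
  obtain ⟨lam, h0, h1⟩ := hfun 1 0
  have hu : u ^ q = 1 := Fact.out
  have hq0 := NeZero.ne q
  interval_cases q
  · exact absurd rfl hq0
  · rw [pow_one] at hu
    rw [hu, one_mul] at h1
    exact one_ne_zero (h0.symm.trans h1)
  · have hx : x + x = (τ : R) * (u * x) := by
      have : u * (u * x) = x := by rw [← mul_assoc, ← pow_two, hu, one_mul]
      rw [this] at hrel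
      linear_combination hrel
    have := congrArg lam hx
    rw [map_add, h0, ← nsmul_eq_mul, map_nsmul, h1, smul_zero] at this
    have h2 : ((2 : ℕ) : ZMod p) = 0 := by rw [Nat.cast_two]; linear_combination this
    rw [ZMod.natCast_eq_zero_iff] at h2
    exact hp2 ((Nat.prime_dvd_prime_iff_eq (Fact.out) Nat.prime_two).1 h2)

/-! ### `τ = 7`: shape `ea = (0, 0, 1)`, `eb = (1, 1, 0)`, `m = (4, 5, 10)`, `n = (4, 8, 3)`, `s = (10, 12, 9)` (`s₂ = 7·s₁ − s₀`), pattern `26/117` -/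

/-- The shape for `τ = 7`. [folklore] -/
def shapeT7 : Shape := ⟨![0, 0, 1], ![1, 1, 0], ![4, 5, 10], ![4, 8, 3]⟩

/-- The prescribed values for `τ = 7`: `s = (10, 12, 9)` on `x, u x, u² x`. [folklore] -/
def sT7 (e : ℕ) : ZMod 13 := if e = 0 then 10 else if e = 1 then 12 else 9

/-- The nine column sets for `τ = 7` (total `26`). [folklore] -/
def AT7 (c : Fin 3 × Fin 3) : Finset (ZMod 13) := (![![{0, 6, 7, 8}, {3, 9}, {2, 3, 7, 9}], ![{3, 5, 10}, {2, 6, 8}, {3, 8}], ![{3, 4, 9, 11}, {0, 2, 8}, {5}]] : Fin 3 → Fin 3 → Finset (ZMod 13)) c.1 c.2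

/-- Separation for `τ = 7` (by `decide`). [folklore] -/
theorem sepT7 : ∀ c c' : Fin 3 × Fin 3, c ≠ c' → ∀ z ∈ AT7 c, ∀ z' ∈ AT7 c', z - z' ≠ shapeT7.delta sT7 c c' := by
  decide +kernel

/-- Count for `τ = 7`: `9·13 ≤ 5·26`. [folklore] -/
theorem bigT7 : 9 * Fintype.card (ZMod 13) ≤ 5 * ∑ c, #(AT7 c) := by
  rw [ZMod.card]; decide +kernel

/-- Exponent bound and separating criterion for `τ = 7` (by `decide`). [folklore] -/
theorem critT7 : (∀ i j : Fin 3, shapeT7.ea i + shapeT7.eb j ≤ 2) ∧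
    (∀ i i' : Fin 3, i ≠ i' → shapeT7.ea i ≠ shapeT7.ea i' ∨ ¬ (13 : ℤ) ∣ shapeT7.m i - shapeT7.m i') ∧
    (∀ j j' : Fin 3, j ≠ j' → shapeT7.eb j ≠ shapeT7.eb j' ∨ ¬ (13 : ℤ) ∣ shapeT7.n j - shapeT7.n j') := by
  decide +kernel

/-- **`p = 13`, rank two, `τ = 7`.** [folklore] -/
theorem not_boxUseful_13_tau7 (x : R) (hrel : u * (u * x) = (7 : R) * (u * x) - x)
    (hfun : ∀ t0 t1 : ZMod 13, ∃ lam : R →+ ZMod 13, lam x = t0 ∧ lam (u * x) = t1) : ¬ BoxUseful (RCyc R q u) := by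
  have hs0 : sT7 0 ≠ 0 := by decide
  have hs2 : (7 : ℕ) • sT7 1 - sT7 0 = sT7 2 := by decide
  haveI : Fact (Nat.Prime 13) := ⟨by norm_num⟩
  have hq : 2 < q := two_lt_q_of_rank_two (p := 13) (by norm_num) 7 (by exact_mod_cast hrel) hfun
  obtain ⟨lam, h0, h1⟩ := hfun (sT7 0) (sT7 1)
  obtain ⟨lam1, h10, -⟩ := hfun 1 0
  have hs : ∀ e, e ≤ 2 → lam (u ^ e * x) = sT7 e := by
    intro e he
    interval_cases e
    · rw [pow_zero, one_mul, h0]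
    · rw [pow_one, h1]
    · rw [pow_two, mul_assoc, hrel, map_sub, h0, show (7 : R) = ((7 : ℕ) : R) by norm_num, ← nsmul_eq_mul, map_nsmul,
        h1, hs2]
  have hsurj : Function.Surjective lam :=
    surjective_of_ne_zero lam (u ^ 0 * x) (by rw [hs 0 (by norm_num)]; exact hs0)
  exact shapeT7.not_boxUseful critT7.1 hq x lam hsurj sT7 hs lam1 h10 critT7.2.1 critT7.2.2 AT7 sepT7 bigT7

/-! ### `τ = 8`: shape `ea = (0, 0, 1)`, `eb = (0, 1, 1)`, `m = (9, 1, 11)`, `n = (12, 9, 11)`, `s = (0, 3, 11)` (`s₂ = 8·s₁ − s₀`), pattern `26/117` -/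

/-- The shape for `τ = 8`. [folklore] -/
def shapeT8 : Shape := ⟨![0, 0, 1], ![0, 1, 1], ![9, 1, 11], ![12, 9, 11]⟩

/-- The prescribed values for `τ = 8`: `s = (0, 3, 11)` on `x, u x, u² x`. [folklore] -/
def sT8 (e : ℕ) : ZMod 13 := if e = 0 then 0 else if e = 1 then 3 else 11

/-- The nine column sets for `τ = 8` (total `26`). [folklore] -/
def AT8 (c : Fin 3 × Fin 3) : Finset (ZMod 13) := (![![{4, 5, 6, 8}, {7, 9, 11}, {7, 8, 10}], ![{2, 3}, {4, 6, 8}, {4, 7, 9, 10}], ![{4, 8}, {0, 11}, {5, 7, 10}]] : Fin 3 → Fin 3 → Finset (ZMod 13)) c.1 c.2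

/-- Separation for `τ = 8` (by `decide`). [folklore] -/
theorem sepT8 : ∀ c c' : Fin 3 × Fin 3, c ≠ c' → ∀ z ∈ AT8 c, ∀ z' ∈ AT8 c', z - z' ≠ shapeT8.delta sT8 c c' := by
  decide +kernel

/-- Count for `τ = 8`: `9·13 ≤ 5·26`. [folklore] -/
theorem bigT8 : 9 * Fintype.card (ZMod 13) ≤ 5 * ∑ c, #(AT8 c) := by
  rw [ZMod.card]; decide +kernel

/-- Exponent bound and separating criterion for `τ = 8` (by `decide`). [folklore] -/
theorem critT8 : (∀ i j : Fin 3, shapeT8.ea i + shapeT8.eb j ≤ 2) ∧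
    (∀ i i' : Fin 3, i ≠ i' → shapeT8.ea i ≠ shapeT8.ea i' ∨ ¬ (13 : ℤ) ∣ shapeT8.m i - shapeT8.m i') ∧
    (∀ j j' : Fin 3, j ≠ j' → shapeT8.eb j ≠ shapeT8.eb j' ∨ ¬ (13 : ℤ) ∣ shapeT8.n j - shapeT8.n j') := by
  decide +kernel

/-- **`p = 13`, rank two, `τ = 8`.** [folklore] -/
theorem not_boxUseful_13_tau8 (x : R) (hrel : u * (u * x) = (8 : R) * (u * x) - x)
    (hfun : ∀ t0 t1 : ZMod 13, ∃ lam : R →+ ZMod 13, lam x = t0 ∧ lam (u * x) = t1) : ¬ BoxUseful (RCyc R q u) := by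
  have hs0 : sT8 1 ≠ 0 := by decide
  have hs2 : (8 : ℕ) • sT8 1 - sT8 0 = sT8 2 := by decide
  haveI : Fact (Nat.Prime 13) := ⟨by norm_num⟩
  have hq : 2 < q := two_lt_q_of_rank_two (p := 13) (by norm_num) 8 (by exact_mod_cast hrel) hfun
  obtain ⟨lam, h0, h1⟩ := hfun (sT8 0) (sT8 1)
  obtain ⟨lam1, h10, -⟩ := hfun 1 0
  have hs : ∀ e, e ≤ 2 → lam (u ^ e * x) = sT8 e := by
    intro e he
    interval_cases e
    · rw [pow_zero, one_mul, h0]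
    · rw [pow_one, h1]
    · rw [pow_two, mul_assoc, hrel, map_sub, h0, show (8 : R) = ((8 : ℕ) : R) by norm_num, ← nsmul_eq_mul, map_nsmul,
        h1, hs2]
  have hsurj : Function.Surjective lam :=
    surjective_of_ne_zero lam (u ^ 1 * x) (by rw [hs 1 (by norm_num)]; exact hs0)
  exact shapeT8.not_boxUseful critT8.1 hq x lam hsurj sT8 hs lam1 h10 critT8.2.1 critT8.2.2 AT8 sepT8 bigT8

/-! ### `τ = 10`: shape `ea = (1, 0, 0)`, `eb = (0, 1, 0)`, `m = (5, 11, 2)`, `n = (12, 12, 6)`, `s = (0, 3, 4)` (`s₂ = 10·s₁ − s₀`), pattern `24/117` -/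

/-- The shape for `τ = 10`. [folklore] -/
def shapeT10 : Shape := ⟨![1, 0, 0], ![0, 1, 0], ![5, 11, 2], ![12, 12, 6]⟩

/-- The prescribed values for `τ = 10`: `s = (0, 3, 4)` on `x, u x, u² x`. [folklore] -/
def sT10 (e : ℕ) : ZMod 13 := if e = 0 then 0 else if e = 1 then 3 else 4

/-- The nine column sets for `τ = 10` (total `24`). [folklore] -/
def AT10 (c : Fin 3 × Fin 3) : Finset (ZMod 13) := (![![{12}, {2, 3, 4, 9, 10}, {10}], ![{1, 8, 12}, {3, 4, 10}, {0, 4, 6}], ![{2, 9}, {0, 1, 2, 7, 8}, {7}]] : Fin 3 → Fin 3 → Finset (ZMod 13)) c.1 c.2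

/-- Separation for `τ = 10` (by `decide`). [folklore] -/
theorem sepT10 : ∀ c c' : Fin 3 × Fin 3, c ≠ c' → ∀ z ∈ AT10 c, ∀ z' ∈ AT10 c', z - z' ≠ shapeT10.delta sT10 c c' := by
  decide +kernel

/-- Count for `τ = 10`: `9·13 ≤ 5·24`. [folklore] -/
theorem bigT10 : 9 * Fintype.card (ZMod 13) ≤ 5 * ∑ c, #(AT10 c) := by
  rw [ZMod.card]; decide +kernel

/-- Exponent bound and separating criterion for `τ = 10` (by `decide`). [folklore] -/
theorem critT10 : (∀ i j : Fin 3, shapeT10.ea i + shapeT10.eb j ≤ 2) ∧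
    (∀ i i' : Fin 3, i ≠ i' → shapeT10.ea i ≠ shapeT10.ea i' ∨ ¬ (13 : ℤ) ∣ shapeT10.m i - shapeT10.m i') ∧
    (∀ j j' : Fin 3, j ≠ j' → shapeT10.eb j ≠ shapeT10.eb j' ∨ ¬ (13 : ℤ) ∣ shapeT10.n j - shapeT10.n j') := by
  decide +kernel

/-- **`p = 13`, rank two, `τ = 10`.** [folklore] -/
theorem not_boxUseful_13_tau10 (x : R) (hrel : u * (u * x) = (10 : R) * (u * x) - x)
    (hfun : ∀ t0 t1 : ZMod 13, ∃ lam : R →+ ZMod 13, lam x = t0 ∧ lam (u * x) = t1) : ¬ BoxUseful (RCyc R q u) := by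
  have hs0 : sT10 1 ≠ 0 := by decide
  have hs2 : (10 : ℕ) • sT10 1 - sT10 0 = sT10 2 := by decide
  haveI : Fact (Nat.Prime 13) := ⟨by norm_num⟩
  have hq : 2 < q := two_lt_q_of_rank_two (p := 13) (by norm_num) 10 (by exact_mod_cast hrel) hfun
  obtain ⟨lam, h0, h1⟩ := hfun (sT10 0) (sT10 1)
  obtain ⟨lam1, h10, -⟩ := hfun 1 0
  have hs : ∀ e, e ≤ 2 → lam (u ^ e * x) = sT10 e := by
    intro e he
    interval_cases e
    · rw [pow_zero, one_mul, h0]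
    · rw [pow_one, h1]
    · rw [pow_two, mul_assoc, hrel, map_sub, h0, show (10 : R) = ((10 : ℕ) : R) by norm_num, ← nsmul_eq_mul, map_nsmul,
        h1, hs2]
  have hsurj : Function.Surjective lam :=
    surjective_of_ne_zero lam (u ^ 1 * x) (by rw [hs 1 (by norm_num)]; exact hs0)
  exact shapeT10.not_boxUseful critT10.1 hq x lam hsurj sT10 hs lam1 h10 critT10.2.1 critT10.2.2 AT10 sepT10 bigT10

/-- **The rank-two atom at `p = 13`.**  `R ⋊_u ℤ/q` is not box-useful whenever `u (u x) = τ (u x) − x` for some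
`τ ∈ {7, 8, 10}` (the traces of the primitive `7`-th roots of unity over `𝔽₁₃`) and every pair of values on `x, u x` is realised
by an additive `λ : R → 𝔽₁₃`; in particular the Schmidt atom `A(13, 7) = 𝔽₁₆₉ ⋊ μ₇`. [folklore] -/
theorem not_boxUseful_13_k2 (x : R) (τ : ℕ) (hτ : τ = 7 ∨ τ = 8 ∨ τ = 10) (hrel : u * (u * x) = (τ : R) * (u * x) - x)
    (hfun : ∀ t0 t1 : ZMod 13, ∃ lam : R →+ ZMod 13, lam x = t0 ∧ lam (u * x) = t1) : ¬ BoxUseful (RCyc R q u) := by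
  rcases hτ with rfl | rfl | rfl
  · exact not_boxUseful_13_tau7 x (by exact_mod_cast hrel) hfun
  · exact not_boxUseful_13_tau8 x (by exact_mod_cast hrel) hfun
  · exact not_boxUseful_13_tau10 x (by exact_mod_cast hrel) hfun

end PowBox

end Summit.MatrixMultiplication.OmegaCensus
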